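import Summits.ABC.StewartYu.PadicG3TwoSizesUnif
import Summits.ABC.StewartYu.PadicG3ParB
import HarnessLib

/-!
# Cell abc-stewartyu, Gen-3 frame at `p = 2` (crux `Y07Two`, stmt-ABC-19659), record interface (F-C): the END/DEPTH
# BLOCK of the schedule of record against the dyadic END data of `PadicG3Par` at `Nq = 2^{m+2}`

`Summits/ABC/StewartYu/PadicG3TwoEndTwo.lean` — cell `abc-stewartyu` (HOME `run/shared/lean/pub/abc-stewartyu/`),
route `PadicPrimesKummerThird`, seat p5 (g3); assigned by the lead p3-g6 (STATUS 2026-08-27T03:32:36Z).  Theorems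
only, for generic `P : PadicG3Par (d+1)` under `hNq : P.Nq = 2^(P.m+2)` (p3's `parTwo`), so that they bind by
`rfl`-lemmas:
* (C1) `L_floor_two : 6·2^{d+25+m} ≤ P.L` and **`hdepth_two : 8·3^{I*} ≤ 4·P.L`** (the depth fit);
* (C2) **`end_range_two : (d+2)·P.Xfin ≤ Nfin I*`** (`P.Xfin = 2ⁿ·Xs Ŝ/(n+1)`, `Ŝ = n+26+m`: `T3 I* ≤ 2·T Ŝ + 1`,
  hence `2·Xs3 I* + 1 ≥ Xs Ŝ` and `3^{d+3} ≥ 2^{n+1}+…`);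
* (C3) **`end_order_two : (d+2)·P.S₀N < Tfin I*`** (`S₀N = M/(n+2)⁴`, `Tfin ≥ M/(n+2)³ + 1`; no `hNq`);
* (C4) **`end_box_two : snoc (Dbox3R I*) (Dθ3R I*) j ≤ P.D j`** (`P.D j = ⌊L/(2^{n+24}Aⱼ)⌋ + 1` here, and
  `Dbox3R I* j ≤ (L/Aⱼ + 2)/2^{n+24+m}`), and `L₀_le_D₀ : P.L₀ ≤ P.D₀`.

WHAT THIS IS NOT: the instantiation `parTwo` itself (p3-g6); no crux moves.

References: Yu. V. Nesterenko, LNM 1819 (2003), §5.2 (5.5)–(5.8); K. Yu, Acta Math. 211 (2013), §6 (6.1)–(6.6).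
-/

noncomputable section

open Finset Real

namespace Summit.ABC.StewartYu

namespace TwoSetup

variable (S : TwoSetup) (P : PadicG3Par (S.d + 1))

/-! ### (C1) the floor on `L` and the depth fit -/

/-- **(C1)** `6·2^{d+25+m} ≤ L` at `Nq = 2^{m+2}` (`L ≥ 2^{n+25}·Nq = 8·2^{d+25+m}`). [cite: Nesterenko2003, (5.6); shape only] -/
theorem L_floor_two (hNq : P.Nq = 2 ^ (P.m + 2)) : 6 * 2 ^ (S.d + 1 + 24 + P.m) ≤ P.L := by
  have h := P.two_pow_mul_Nq_le_L
  rw [hNq, ← pow_add] at h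
  have e : 2 ^ (S.d + 1 + 25 + (P.m + 2)) = 8 * 2 ^ (S.d + 1 + 24 + P.m) := by
    rw [show S.d + 1 + 25 + (P.m + 2) = 3 + (S.d + 1 + 24 + P.m) by ring, pow_add]; norm_num
  rw [e] at h
  omega

/-- **The depth fit** `8·3^{I*} ≤ 4L` at `Nq = 2^{m+2}`. [cite: Nesterenko2003, (3.24); shape only] -/
theorem hdepth_two (hNq : P.Nq = 2 ^ (P.m + 2)) : 8 * 3 ^ S.Istar3 P ≤ 4 * P.L :=
  S.depth_fit_of_le P (S.L_floor_two P hNq)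

/-! ### (C3) the END order -/

/-- **(C3)** `(d+2)·S₀N < Tfin I*` (`S₀N = ⌊M/(n+2)⁴⌋`, `Tfin ≥ ⌊M/(n+2)³⌋ + 1`). [cite: Nesterenko2003, (5.8); shape only] -/
theorem end_order_two : (S.d + 1 + 1) * P.S₀N < (S.schedTwoS P).Tfin (S.Istar3 P) := by
  have hT := S.Tfin_schedTwoS_ge P (S.Istar3 P)
  unfold PadicG3Par.S₀N
  have h1 : (S.d + 1 + 1) * (P.M / (S.d + 1 + 2) ^ 4) ≤ P.M / (S.d + 1 + 2) ^ 3 := by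
    rw [pow_succ, ← Nat.div_div_eq_div_mul]
    calc (S.d + 1 + 1) * (P.M / (S.d + 1 + 2) ^ 3 / (S.d + 1 + 2))
        ≤ (S.d + 1 + 2) * (P.M / (S.d + 1 + 2) ^ 3 / (S.d + 1 + 2)) := Nat.mul_le_mul_right _ (by omega)
      _ ≤ P.M / (S.d + 1 + 2) ^ 3 := by rw [mul_comm]; exact Nat.div_mul_le_self _ _
  omega

/-! ### (C2) the END range -/

/-- `⌊2a/D⌋ ≤ 2⌊a/D⌋ + 1`. [folklore] -/
theorem two_mul_div_le (a D : ℕ) (hD : 0 < D) : 2 * a / D ≤ 2 * (a / D) + 1 := by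
  have h : a < D * (a / D + 1) := by
    have := Nat.lt_div_mul_add hD (a := a)
    linarith [Nat.div_add_mod a D, Nat.mod_lt a hD]
  have h2 : 2 * a < (2 * (a / D) + 2) * D := by nlinarith
  have := (Nat.div_lt_iff_lt_mul hD).mpr h2
  omega

/-- The depth of the dyadic record at `Nq = 2^{m+2}`: `Ŝ = d + 27 + m`. [folklore] -/
theorem Sdepth_two (hNq : P.Nq = 2 ^ (P.m + 2)) : P.Sdepth = S.d + 1 + 24 + (P.m + 2) := by
  unfold PadicG3Par.Sdepth
  rw [hNq, Nat.log_pow (by norm_num)]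

/-- `T3 I* ≤ 2·T Ŝ + 1` at `Nq = 2^{m+2}`. [folklore] -/
theorem T3_Istar3_le_two_mul_T (hNq : P.Nq = 2 ^ (P.m + 2)) : S.T3 P (S.Istar3 P) ≤ 2 * P.T P.Sdepth + 1 := by
  have h1 := S.T3_Istar3_le P
  unfold PadicG3Par.T
  rw [S.Sdepth_two P hNq]
  -- `8L/2^{d+27+m} = 2L/2^{d+25+m}` and `4L/2^{d+25+m} ≤ 2·(2L/2^{d+25+m}) + 1`
  have e : 8 * P.L / 2 ^ (S.d + 1 + 24 + (P.m + 2)) = 2 * P.L / 2 ^ (S.d + 1 + 24 + P.m) := by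
    rw [show S.d + 1 + 24 + (P.m + 2) = (S.d + 1 + 24 + P.m) + 2 by ring, pow_add,
      show (2 : ℕ) ^ 2 = 4 by norm_num, show 8 * P.L = (2 * P.L) * 4 by ring,
      mul_comm (2 ^ (S.d + 1 + 24 + P.m)) 4, ← Nat.div_div_eq_div_mul, Nat.mul_div_cancel _ (by norm_num)]
  rw [e]
  have h2 := two_mul_div_le (2 * P.L) (2 ^ (S.d + 1 + 24 + P.m)) (by positivity)
  rw [show 2 * (2 * P.L) = 4 * P.L by ring] at h2
  omega

/-- **(C2)** `(d+2)·Xfin ≤ Nfin I*` at `Nq = 2^{m+2}`. [cite: Nesterenko2003, §5.2 (5.5); shape only] -/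
theorem end_range_two (hNq : P.Nq = 2 ^ (P.m + 2)) :
    (S.d + 1 + 1) * P.Xfin ≤ (S.schedTwoS P).Nfin (S.Istar3 P) := by
  rw [S.Nfin_schedTwoS_eq P]
  have hT := S.T3_Istar3_le_two_mul_T P hNq
  set T := P.T P.Sdepth with hTdef
  set T' := S.T3 P (S.Istar3 P) with hT'def
  have hX : 72 ≤ P.X := P.seventytwo_le_X'
  have hL : 1 ≤ P.L := le_trans Nat.one_le_two_pow P.two_pow_le_L
  -- `y := 2XL/(T+1)`: `Xs3 I* ≥ y`, `Xs Ŝ ≤ 2y + 1`, `y ≥ 1`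
  set y := 2 * P.X * P.L / (T + 1) with hy
  have hXs3 : y ≤ 4 * P.X * P.L / (T' + 1) := by
    calc y = 2 * (2 * P.X * P.L) / (2 * (T + 1)) := (Nat.mul_div_mul_left _ _ (by norm_num)).symm
      _ = 4 * P.X * P.L / (2 * (T + 1)) := by ring_nf
      _ ≤ 4 * P.X * P.L / (T' + 1) := Nat.div_le_div_left (by omega) (by omega)
  have hXs : P.Xs P.Sdepth ≤ 2 * y + 1 := by
    unfold PadicG3Par.Xs
    rw [← hTdef, hy, show 4 * P.X * P.L = 2 * (2 * P.X * P.L) by ring]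
    exact two_mul_div_le _ _ (by omega)
  have hy1 : 1 ≤ y := by
    rw [hy, Nat.le_div_iff_mul_le (by omega), one_mul]
    -- `T + 1 ≤ 2XL`: `T = 8L/2^Ŝ ≤ 8L ≤ 2·72·L − 1`
    have : T ≤ 8 * P.L := by rw [hTdef]; unfold PadicG3Par.T; exact Nat.div_le_self _ _
    nlinarith
  -- `(d+2)·Xfin ≤ 2^{d+1}·Xs Ŝ ≤ 2^{d+1}(2y+1) ≤ 3^{d+3}·y ≤ 3^{d+3}·Xs3 I*`
  unfold PadicG3Par.Xfin
  have h1 : (S.d + 1 + 1) * (2 ^ (S.d + 1) * P.Xs P.Sdepth / (S.d + 1 + 1)) ≤ 2 ^ (S.d + 1) * P.Xs P.Sdepth := by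
    rw [mul_comm]; exact Nat.div_mul_le_self _ _
  have h2 : 2 ^ (S.d + 1) * P.Xs P.Sdepth ≤ 2 ^ (S.d + 1) * (2 * y + 1) := Nat.mul_le_mul_left _ hXs
  have h3 : 2 ^ (S.d + 1) * (2 * y + 1) ≤ 3 ^ (S.d + 3) * y := by
    have h23 : 2 ^ S.d ≤ 3 ^ S.d := Nat.pow_le_pow_left (by norm_num) _
    calc 2 ^ (S.d + 1) * (2 * y + 1) = 2 ^ S.d * (4 * y + 2) := by rw [pow_succ]; ring
      _ ≤ 3 ^ S.d * (4 * y + 2) := Nat.mul_le_mul_right _ h23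
      _ ≤ 3 ^ S.d * (27 * y) := Nat.mul_le_mul_left _ (by omega)
      _ = 3 ^ (S.d + 3) * y := by rw [pow_add]; ring
  have h4 : 3 ^ (S.d + 3) * y ≤ 3 ^ (S.d + 3) * (4 * P.X * P.L / (T' + 1)) := Nat.mul_le_mul_left _ hXs3
  exact h1.trans (h2.trans (h3.trans h4))

/-! ### (C4) the END boxes -/

/-- A natural number `≤ x + 1/2` is `≤ ⌊x⌋ + 1`. [folklore] -/
theorem nat_le_floor_add_one {N : ℕ} {x : ℝ} (h : (N : ℝ) ≤ x + 1 / 2) : N ≤ ⌊x⌋₊ + 1 := by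
  by_contra hN
  have hN' : ⌊x⌋₊ + 2 ≤ N := by omega
  have hlt := Nat.lt_floor_add_one x
  have : ((⌊x⌋₊ + 2 : ℕ) : ℝ) ≤ N := by exact_mod_cast hN'
  push_cast at this
  linarith

/-- `Istar3 ≥ 1`. [folklore] -/
theorem Istar3_pos : 0 < S.Istar3 P := by
  unfold Istar3
  exact Nat.clog_pos (by norm_num) (Nat.one_lt_two_pow (by omega))

/-- The END box of a free generator: `Dbox3R I* j ≤ (L/Aⱼ + 2)/2^{d+25+m}` as a real. [folklore] -/
theorem Dbox3R_Istar_real_le (j : Fin S.d) :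
    (S.Dbox3R P (S.Istar3 P) j : ℝ) ≤ ((P.L : ℝ) / P.A (Fin.castSucc j) + 2) / 2 ^ (S.d + 1 + 24 + P.m) := by
  have h := S.Dbox3R_real_le P (S.Istar3 P) j
  have hA := S.A_pos P (Fin.castSucc j)
  have h3 : (2 : ℝ) ^ (S.d + 1 + 24 + P.m) ≤ (3 : ℝ) ^ S.Istar3 P := by
    exact_mod_cast S.two_pow_le_three_pow_Istar3 P
  have hnum : 0 ≤ (P.L : ℝ) / P.A (Fin.castSucc j) + 2 := by positivity
  have e : 2 * ((P.L : ℝ) / (2 * P.A (Fin.castSucc j)) + 1) = (P.L : ℝ) / P.A (Fin.castSucc j) + 2 := by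
    field_simp
  rw [e] at h
  exact h.trans (div_le_div_of_nonneg_left hnum (by positivity) h3)

/-- The END box in `θ`: `Dθ3R I* ≤ (L/A_θ + 2)/2^{d+25+m}` as a real. [folklore] -/
theorem Dθ3R_Istar_real_le :
    (S.Dθ3R P (S.Istar3 P) : ℝ) ≤ ((P.L : ℝ) / P.A (Fin.last S.d) + 2) / 2 ^ (S.d + 1 + 24 + P.m) := by
  have h := S.Dθ3R_real_le P (S.Istar3 P)
  have hA := S.A_pos P (Fin.last S.d)
  have h3 : (2 : ℝ) ^ (S.d + 1 + 24 + P.m) ≤ (3 : ℝ) ^ S.Istar3 P := by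
    exact_mod_cast S.two_pow_le_three_pow_Istar3 P
  have hnum : 0 ≤ (P.L : ℝ) / P.A (Fin.last S.d) + 2 := by positivity
  have e : 2 * ((P.L : ℝ) / (2 * P.A (Fin.last S.d)) + 1) = (P.L : ℝ) / P.A (Fin.last S.d) + 2 := by
    field_simp
  rw [e] at h
  exact h.trans (div_le_div_of_nonneg_left hnum (by positivity) h3)

/-- The comparison of a box bound `(L/A + 2)/2^{d+25+m}` with the record's `⌊L/(2^{d+25}A)⌋ + 1`. [folklore] -/
theorem box_le_record {N : ℕ} {A : ℝ} (hA : 0 < A)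
    (hN : (N : ℝ) ≤ ((P.L : ℝ) / A + 2) / 2 ^ (S.d + 1 + 24 + P.m)) :
    N ≤ ⌊(P.L : ℝ) / (2 ^ (S.d + 1 + 24) * A)⌋₊ + 1 := by
  refine nat_le_floor_add_one (hN.trans ?_)
  have hL : (0 : ℝ) ≤ P.L := by positivity
  have h2m : (1 : ℝ) ≤ (2 : ℝ) ^ P.m := one_le_pow₀ (by norm_num)
  have hD : (0 : ℝ) < (2 : ℝ) ^ (S.d + 1 + 24) := by positivity
  rw [pow_add, div_le_iff₀ (by positivity)]
  have e : (P.L : ℝ) / (2 ^ (S.d + 1 + 24) * A) * (2 ^ (S.d + 1 + 24) * (2 : ℝ) ^ P.m) =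
      (P.L : ℝ) / A * (2 : ℝ) ^ P.m := by field_simp
  rw [add_mul, e]
  have hLA : 0 ≤ (P.L : ℝ) / A := by positivity
  have h24 : (2 : ℝ) ^ 25 ≤ (2 : ℝ) ^ (S.d + 1 + 24) := pow_le_pow_right₀ (by norm_num) (by omega)
  nlinarith [mul_le_mul_of_nonneg_left h2m hLA, mul_le_mul h24 h2m (by positivity) (by positivity)]

/-- **(C4)** the END boxes are below the record's `P.D` at `Nq = 2^{m+2}`. [cite: Nesterenko2003, §5.2 (5.7); shape only] -/
theorem end_box_two (hNq : P.Nq = 2 ^ (P.m + 2)) (j : Fin (S.d + 1)) :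
    (Fin.snoc (S.Dbox3R P (S.Istar3 P)) (S.Dθ3R P (S.Istar3 P)) : Fin (S.d + 1) → ℕ) j ≤ P.D j := by
  unfold PadicG3Par.D
  rw [S.Sdepth_two P hNq, hNq]
  -- `Nq·L/(2^Ŝ·A) = L/(2^{d+25}·A)`
  have e : ∀ A : ℝ, 0 < A → ((2 ^ (P.m + 2) : ℕ) : ℝ) * P.L / (2 ^ (S.d + 1 + 24 + (P.m + 2)) * A) =
      (P.L : ℝ) / (2 ^ (S.d + 1 + 24) * A) := by
    intro A hA
    push_cast
    rw [pow_add (2 : ℝ) (S.d + 1 + 24) (P.m + 2)]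
    field_simp
  refine Fin.lastCases ?_ (fun j' => ?_) j
  · simp only [Fin.snoc_last]
    rw [e _ (S.A_pos P _)]
    exact S.box_le_record P (S.A_pos P _) (S.Dθ3R_Istar_real_le P)
  · simp only [Fin.snoc_castSucc]
    rw [e _ (S.A_pos P _)]
    exact S.box_le_record P (S.A_pos P _) (S.Dbox3R_Istar_real_le P j')

/-- `P.L₀ ≤ P.D₀` (`D₀ = L₀ + 1`). [folklore] -/
theorem L₀_le_D₀ : P.L₀ ≤ P.D₀ := by unfold PadicG3Par.D₀; omega

/-- The schedule's `D₀` slot is below the record's. [folklore] -/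
theorem D₀_schedTwoS_le : (S.schedTwoS P).D₀ ≤ P.D₀ := by rw [schedTwoS_D₀]; exact S.L₀_le_D₀ P

end TwoSetup

end Summit.ABC.StewartYu

end
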